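/-
Copyright (c) 2026 the pub-hodgecm-mathlib formalisation cell (harness21).  Prover seat hodgecm-mathlib-LH4-p14 (g6), 2026-09-04 — β-BOARD v1 (sub-dealer LH4-p05 (g8)) rows R3∕R4∕R5
«ε-BOUNDARY LAYERS», the ARITHMETIC HALF (pair LH4-p13 (g8) × LH4-p14 (g6)): the double F-side character sums of a binary LINEAR form.
-/
import Literature.NumberTheory.LocalFields.WildQuadraticDatumNormSignConductor   -- ★ (LH4-p06 (g3)) the ω-conductor toolkit
import HarnessLib

/-!
# Crux `H413`, line LH4 «(D-RAM) FOUR-FRAME», STAGE-1b (β) table — THE DOUBLE CHARACTER SUMS OF A BINARY LINEAR FORM over a fixed-unit residue system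

Cell `hodgecm-mathlib` (D-0151), FLOOR 0, crux item H413 = `stmt-HodgeConjecture-24833`, route `HCCMUnconditional`; squad LH4; lane `--supports stmt-HodgeConjecture-24833 --as helper`.
THEOREMS ONLY (no `def`, no instance, no `sorry`, default heartbeats); pure local arithmetic; COUNT-NEUTRAL.

WHY (β-BOARD v1 R3∕R4∕R5).  After ★ p860847 (LH4-p13 (g8): `2·labelledOddCount = ω(D₁ᵢ)·Σ_{r ∈ R} ω(rᵢ)(1 + λ(r))`, `λ(r) = ω(r₀G₀ + r₁G₁)`) and LH4-p09 (g9)'s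
product transversal `R₀ = {1,c} × A × A`, every ε-boundary tower row is a DOUBLE sum over a fixed-unit residue system `A` (mod `|ϖ|^{2e}`, `e ≥ d`) of
`χ(u,u′)·ω(C₀u′ + C₁ϖ_F^j u)` with `χ ∈ {ω(u′), ω(u), 1}` (`C₀, C₁` fixed units, `ϖ_F = ϖσϖ`, `j ≥ 1` the twist depth in F-exponent).  THIS FILE evaluates all three:
* §1 `normSign_linear_eq_mul` — the factorisation `ω(C₀u′ + C₁ϖ_F^j u) = ω(u′)·ω(C₀ + C₁ϖ_F^j·(u∕u′))`; `normSign_affine_eq_of_near` — class invariance at precision `2e ≥ 2d − 1`.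
* §2 `sum_normSign_linear_eq` — the INNER sum at fixed `u′`: `Σ_{u ∈ A} ω(C₀u′ + C₁ϖ_F^j u) = ω(u′)·Σ_{a ∈ A} ω(C₀ + C₁ϖ_F^j a)` (bijection `u ↦ rep(u∕u′)`).
* §3 the three double sums: (iii) `sum_sum_normSign_linear_eq_zero` `= 0`; (i) `sum_sum_normSign_snd_mul_linear_eq` `= #A · Σ_{a ∈ A} ω(C₀ + C₁ϖ_F^j a)` (the inner sum is
  ★ FILE 1 (LH4-p14): `#A·ω(C₀)` for `j ≥ d`, `0` for `1 ≤ j ≤ d − 2` at precision `2(d−j)`, the conductor value at `j = d − 1`); (ii) `sum_normSign_mul_affine_eq_zero` — the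
  twisted single sum `Σ_{a ∈ A} ω(a)·ω(C₀ + C₁ϖ_F^j a) = 0` (toolkit involution `a ↦ rep(c·a)`, `c ∈ U_F(2d−2)` non-norm: the twist flips, the value does not move) and hence
  `sum_sum_normSign_fst_mul_linear_eq_zero` `= 0`.
HONEST LABEL.  Count-neutral; table∕(β-BAL)∕(β)∕T₊ stay OPEN; HC_CM is proved only modulo the 7 printed citations (2 remaining named inputs: hLiu418 = `stmt-HodgeConjecture-24832`,
h413 = `stmt-HodgeConjecture-24833`) until rung 0 closes.

## References
* [Serre1979] J.-P. Serre, *Local Fields*, GTM 67 (1979) — Ch. V §3 Prop. 5, Cor. 2–3, Ch. XV §2.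
* [NeukirchANT1999] J. Neukirch, *Algebraic Number Theory* (1999) — Ch. V (1.3).
-/

set_option autoImplicit false

noncomputable section

namespace Summit.HodgeConjecture.HodgeConjecture.Cruxes.H413.F0P3cDyRamBinaryLinearFormDoubleSums

open WithZero
open scoped Valued
open Literature.NumberTheory.Automorphic.UnitaryThreeFourFrame
open Literature.NumberTheory.LocalFields.WildQuadraticDatum

variable {K : Type} [Field K] [Valued K ℤᵐ⁰] {σ : K →+* K} {ϖ : K} {d t : ℕ}

/-! ## §1  Factorisation and class invariance -/

/-- The value `C₀ + C₁ϖ_F^j x` is a UNIT for a unit `x`, a unit `C₀`, `|C₁| ≤ 1` and `j ≥ 1`. [cite: Serre1979, Ch. V §3] -/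
theorem v_affine_eq_one (hD : IsRamifiedQuadraticDatum σ ϖ d t) {C₀ C₁ x : K} (hC₀ : Valued.v C₀ = 1) (hC₁ : Valued.v C₁ ≤ 1) (hx : Valued.v x ≤ 1) {j : ℕ} (hj : 1 ≤ j) :
    Valued.v (C₀ + C₁ * (ϖ * σ ϖ) ^ j * x) = 1 := by
  obtain ⟨-, hvσ, hϖ, -, -, -, -⟩ := id hD
  have hϖlt : Valued.v ϖ < 1 := by rw [hϖ, ← exp_zero]; exact exp_lt_exp.2 (by norm_num)
  have hlt : Valued.v (C₁ * (ϖ * σ ϖ) ^ j * x) < Valued.v C₀ := by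
    rw [hC₀, map_mul, map_mul, map_pow, map_mul, hvσ]
    calc Valued.v C₁ * (Valued.v ϖ * Valued.v ϖ) ^ j * Valued.v x ≤ 1 * (Valued.v ϖ * Valued.v ϖ) ^ j * 1 :=
          mul_le_mul' (mul_le_mul' hC₁ le_rfl) hx
      _ < 1 := by
          rw [one_mul, mul_one]
          exact pow_lt_one₀ zero_le (mul_lt_one_of_lt_of_le hϖlt hϖlt.le) (by omega)
  rw [Valuation.map_add_eq_of_lt_left _ hlt, hC₀]

/-- **FACTORISATION**: for fixed `u′ ≠ 0` and fixed `u`, `ω(C₀u′ + C₁ϖ_F^j u) = ω(u′)·ω(C₀ + C₁ϖ_F^j·(u∕u′))` when the second factor is non-zero (fixed `Cᵢ`). [cite: Serre1979, Ch. V §3 Cor. 3] -/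
theorem normSign_linear_eq_mul [CompleteSpace K] [Finite 𝓀[K]] (hD : IsRamifiedQuadraticDatum σ ϖ d t) {C₀ C₁ u u' : K} (hσC₀ : σ C₀ = C₀) (hσC₁ : σ C₁ = C₁)
    (hσu : σ u = u) (hσu' : σ u' = u') (hu'0 : u' ≠ 0) (j : ℕ) (hval0 : C₀ + C₁ * (ϖ * σ ϖ) ^ j * (u / u') ≠ 0) :
    normSign σ (C₀ * u' + C₁ * (ϖ * σ ϖ) ^ j * u) = normSign σ u' * normSign σ (C₀ + C₁ * (ϖ * σ ϖ) ^ j * (u / u')) := by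
  obtain ⟨hσ, -, -, -, -, -, -⟩ := id hD
  have hπ : σ (ϖ * σ ϖ) = ϖ * σ ϖ := by rw [map_mul, hσ, mul_comm]
  have e : C₀ * u' + C₁ * (ϖ * σ ϖ) ^ j * u = u' * (C₀ + C₁ * (ϖ * σ ϖ) ^ j * (u / u')) := by field_simp
  rw [e, normSign_mul_of_fixed hD hσu' (by rw [map_add, hσC₀, map_mul, map_mul, hσC₁, map_pow, hπ, map_div₀, hσu, hσu']) hu'0 hval0]

/-- **CLASS INVARIANCE**: for fixed units `x, x′` with `|x − x′| ≤ |ϖ|^{2e}`, `2d − 1 ≤ 2e`, and `j ≥ 1`: `ω(C₀ + C₁ϖ_F^j x′) = ω(C₀ + C₁ϖ_F^j x)`. [cite: Serre1979, Ch. XV §2 Cor. 2] -/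
theorem normSign_affine_eq_of_near [CompleteSpace K] (hD : IsRamifiedQuadraticDatum σ ϖ d t) {C₀ C₁ x x' : K} (hσC₀ : σ C₀ = C₀) (hC₀ : Valued.v C₀ = 1)
    (hσC₁ : σ C₁ = C₁) (hC₁ : Valued.v C₁ ≤ 1) (hσx : σ x = x) (hx : Valued.v x ≤ 1) (hσx' : σ x' = x')
    {j e : ℕ} (hj : 1 ≤ j) (he : 2 * d - 1 ≤ 2 * e) (hnear : Valued.v (x - x') ≤ Valued.v ϖ ^ (2 * e)) :
    normSign σ (C₀ + C₁ * (ϖ * σ ϖ) ^ j * x') = normSign σ (C₀ + C₁ * (ϖ * σ ϖ) ^ j * x) := by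
  obtain ⟨hσ, hvσ, hϖ, -, -, -, -⟩ := id hD
  have hϖ1 : Valued.v ϖ ≤ 1 := by rw [hϖ, ← exp_zero]; exact exp_le_exp.2 (by norm_num)
  have hπ : σ (ϖ * σ ϖ) = ϖ * σ ϖ := by rw [map_mul, hσ, mul_comm]
  have hfx : ∀ y : K, σ y = y → σ (C₀ + C₁ * (ϖ * σ ϖ) ^ j * y) = C₀ + C₁ * (ϖ * σ ϖ) ^ j * y := fun y hy => by
    rw [map_add, hσC₀, map_mul, map_mul, hσC₁, map_pow, hπ, hy]
  refine normSign_eq_of_near hD (hfx x hσx) (hfx x' hσx') (v_affine_eq_one hD hC₀ hC₁ hx hj) he ?_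
  rw [show C₀ + C₁ * (ϖ * σ ϖ) ^ j * x - (C₀ + C₁ * (ϖ * σ ϖ) ^ j * x') = C₁ * (ϖ * σ ϖ) ^ j * (x - x') by ring, map_mul, map_mul]
  calc Valued.v C₁ * Valued.v ((ϖ * σ ϖ) ^ j) * Valued.v (x - x') ≤ 1 * 1 * Valued.v ϖ ^ (2 * e) :=
        mul_le_mul' (mul_le_mul' hC₁ (by rw [map_pow, map_mul, hvσ]; exact pow_le_one₀ zero_le (mul_le_one' hϖ1 hϖ1))) hnear
    _ = Valued.v ϖ ^ (2 * e) := by rw [one_mul, one_mul]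

/-! ## §2  The inner sum at fixed `u′` -/

/-- **THE INNER SUM**: `A` a complete irredundant system of the fixed units modulo `|ϖ|^{2e}` (`2d − 1 ≤ 2e`), `u′ ∈ A`, `C₀, C₁` fixed with `|C₀| = 1 ≥ |C₁|`, `j ≥ 1`:
`Σ_{u ∈ A} ω(C₀u′ + C₁ϖ_F^j u) = ω(u′) · Σ_{a ∈ A} ω(C₀ + C₁ϖ_F^j a)` — the map `u ↦ rep(u∕u′)` permutes `A` and `ω(C₀ + C₁ϖ_F^j ·)` is a class function.
[cite: Serre1979, Ch. V §3 Cor. 3; Ch. XV §2] -/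
theorem sum_normSign_linear_eq [CompleteSpace K] [Finite 𝓀[K]] (hD : IsRamifiedQuadraticDatum σ ϖ d t)
    {C₀ C₁ : K} (hσC₀ : σ C₀ = C₀) (hC₀ : Valued.v C₀ = 1) (hσC₁ : σ C₁ = C₁) (hC₁ : Valued.v C₁ ≤ 1) {j e : ℕ} (hj : 1 ≤ j) (he : 2 * d - 1 ≤ 2 * e)
    (A : Finset K) (hA₁ : ∀ a ∈ A, σ a = a ∧ Valued.v a = 1)
    (hA₂ : ∀ u : K, σ u = u → Valued.v u = 1 → ∃ a ∈ A, Valued.v (u - a) ≤ Valued.v ϖ ^ (2 * e))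
    (hA₃ : ∀ a ∈ A, ∀ a' ∈ A, Valued.v (a - a') ≤ Valued.v ϖ ^ (2 * e) → a = a') {u' : K} (hu' : u' ∈ A) :
    ∑ u ∈ A, normSign σ (C₀ * u' + C₁ * (ϖ * σ ϖ) ^ j * u) = normSign σ u' * ∑ a ∈ A, normSign σ (C₀ + C₁ * (ϖ * σ ϖ) ^ j * a) := by
  classical
  obtain ⟨hσ, hvσ, hϖ, -, -, hd1, -⟩ := id hD
  obtain ⟨hσu', hu'1⟩ := hA₁ u' hu'
  have hu'0 : u' ≠ 0 := fun h => by rw [h, map_zero] at hu'1; exact zero_ne_one hu'1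
  have hsmall : Valued.v ϖ ^ (2 * e) < 1 := by
    rw [hϖ, ← exp_nsmul, nsmul_eq_mul, mul_neg, mul_one, ← exp_zero]; exact exp_lt_exp.2 (by omega)
  -- the quotient map and its representative
  have hq : ∀ u ∈ A, σ (u / u') = u / u' ∧ Valued.v (u / u') = 1 := fun u hu => by
    obtain ⟨hσu, hu1⟩ := hA₁ u hu
    exact ⟨by rw [map_div₀, hσu, hσu'], by rw [map_div₀, hu1, hu'1, div_one]⟩
  have hrep : ∀ u ∈ A, ∃ a ∈ A, Valued.v (u / u' - a) ≤ Valued.v ϖ ^ (2 * e) := fun u hu => hA₂ _ (hq u hu).1 (hq u hu).2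
  choose! Φ hΦA hΦ using hrep
  -- termwise: `ω(C₀u′ + C₁ϖ_F^j u) = ω(u′)·ω(C₀ + C₁ϖ_F^j Φ u)`
  have hterm : ∀ u ∈ A, normSign σ (C₀ * u' + C₁ * (ϖ * σ ϖ) ^ j * u) = normSign σ u' * normSign σ (C₀ + C₁ * (ϖ * σ ϖ) ^ j * Φ u) := by
    intro u hu
    have hv1 := v_affine_eq_one hD hC₀ hC₁ (hq u hu).2.le hj
    rw [normSign_linear_eq_mul hD hσC₀ hσC₁ (hA₁ u hu).1 hσu' hu'0 j (fun h => by rw [h, map_zero] at hv1; exact zero_ne_one hv1),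
      normSign_affine_eq_of_near hD hσC₀ hC₀ hσC₁ hC₁ (hq u hu).1 (hq u hu).2.le (hA₁ _ (hΦA u hu)).1 hj he (hΦ u hu)]
  rw [Finset.sum_congr rfl hterm, ← Finset.mul_sum]
  congr 1
  -- `Φ` is a bijection of `A`
  have hinj : ∀ u₁ ∈ A, ∀ u₂ ∈ A, Φ u₁ = Φ u₂ → u₁ = u₂ := by
    intro u₁ hu₁ u₂ hu₂ heq
    refine hA₃ u₁ hu₁ u₂ hu₂ ?_
    have h1 : Valued.v (u₁ / u' - u₂ / u') ≤ Valued.v ϖ ^ (2 * e) := by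
      rw [show u₁ / u' - u₂ / u' = (u₁ / u' - Φ u₁) - (u₂ / u' - Φ u₂) by rw [heq]; ring]
      exact (Valuation.map_sub _ _ _).trans (max_le (hΦ u₁ hu₁) (hΦ u₂ hu₂))
    rwa [← sub_div, map_div₀, hu'1, div_one] at h1
  exact Finset.sum_bij (fun u _ => Φ u) (fun u hu => hΦA u hu) (fun u₁ hu₁ u₂ hu₂ h => hinj u₁ hu₁ u₂ hu₂ h)
    (fun a ha => by
      have himg : A.image Φ = A := Finset.eq_of_subset_of_card_le (Finset.image_subset_iff.2 fun u hu => hΦA u hu)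
        (by rw [Finset.card_image_of_injOn (fun u₁ hu₁ u₂ hu₂ h => hinj u₁ hu₁ u₂ hu₂ h)])
      have ha' : a ∈ A.image Φ := by rw [himg]; exact ha
      obtain ⟨u, hu, hua⟩ := Finset.mem_image.1 ha'
      exact ⟨u, hu, hua⟩)
    (fun _ _ => rfl)

/-! ## §3  The three double sums -/

/-- **(iii) THE PLAIN DOUBLE SUM VANISHES**: `Σ_{u ∈ A} Σ_{u′ ∈ A} ω(C₀u′ + C₁ϖ_F^j u) = 0` (`|2| < 1`, `2d − 1 ≤ 2e`, `j ≥ 1`): after §2 it is `(Σ_{u′} ω(u′))·(Σ_a ω(C₀ + C₁ϖ_F^j a))`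
and the first factor vanishes (★ `sum_normSign_repr_eq_zero`: `ω` sums to zero over the fixed unit classes). [cite: Serre1979, Ch. V §3 Cor. 3; Ch. XV §2] -/
theorem sum_sum_normSign_linear_eq_zero [CompleteSpace K] [Finite 𝓀[K]] (hD : IsRamifiedQuadraticDatum σ ϖ d t) (h2v : Valued.v (2 : K) < 1)
    {C₀ C₁ : K} (hσC₀ : σ C₀ = C₀) (hC₀ : Valued.v C₀ = 1) (hσC₁ : σ C₁ = C₁) (hC₁ : Valued.v C₁ ≤ 1) {j e : ℕ} (hj : 1 ≤ j) (he : 2 * d - 1 ≤ 2 * e)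
    (A : Finset K) (hA₁ : ∀ a ∈ A, σ a = a ∧ Valued.v a = 1)
    (hA₂ : ∀ u : K, σ u = u → Valued.v u = 1 → ∃ a ∈ A, Valued.v (u - a) ≤ Valued.v ϖ ^ (2 * e))
    (hA₃ : ∀ a ∈ A, ∀ a' ∈ A, Valued.v (a - a') ≤ Valued.v ϖ ^ (2 * e) → a = a') :
    ∑ u ∈ A, ∑ u' ∈ A, normSign σ (C₀ * u' + C₁ * (ϖ * σ ϖ) ^ j * u) = 0 := by
  classical
  rw [Finset.sum_comm]
  have hin : ∀ u' ∈ A, ∑ u ∈ A, normSign σ (C₀ * u' + C₁ * (ϖ * σ ϖ) ^ j * u) = normSign σ u' * ∑ a ∈ A, normSign σ (C₀ + C₁ * (ϖ * σ ϖ) ^ j * a) :=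
    fun u' hu' => sum_normSign_linear_eq hD hσC₀ hC₀ hσC₁ hC₁ hj he A hA₁ hA₂ hA₃ hu'
  rw [Finset.sum_congr rfl hin, ← Finset.sum_mul]
  have hF1 : ∑ u' ∈ A, normSign σ u' = 0 :=
    sum_normSign_repr_eq_zero hD h2v (A := {f : K | σ f = f ∧ Valued.v f = 1}) he (fun f hf => hf)
      (fun f hf a hσa ha1 _ => ⟨by rw [map_mul, hσa, hf.1], by rw [map_mul, ha1, hf.2, one_mul]⟩) A (fun g hg => hA₁ g hg)
      (fun f hf => hA₂ f hf.1 hf.2) hA₃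
  rw [hF1, zero_mul]

/-- **(i) THE `ω(u′)`-WEIGHTED DOUBLE SUM**: `Σ_{u ∈ A} Σ_{u′ ∈ A} ω(u′)·ω(C₀u′ + C₁ϖ_F^j u) = #A · Σ_{a ∈ A} ω(C₀ + C₁ϖ_F^j a)` (`ω(u′)² = 1`); the remaining single sum is
★ FILE 1 (`sum_normSign_binaryNormForm_of_le`-type for `j ≥ d`: `#A·ω(C₀)`; `sum_normSign_affine_repr_eq_zero` for `1 ≤ j ≤ d − 2` at `e = d − j`; the conductor value at
`j = d − 1`). [cite: Serre1979, Ch. V §3 Cor. 3; Ch. XV §2] -/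
theorem sum_sum_normSign_snd_mul_linear_eq [CompleteSpace K] [Finite 𝓀[K]] (hD : IsRamifiedQuadraticDatum σ ϖ d t)
    {C₀ C₁ : K} (hσC₀ : σ C₀ = C₀) (hC₀ : Valued.v C₀ = 1) (hσC₁ : σ C₁ = C₁) (hC₁ : Valued.v C₁ ≤ 1) {j e : ℕ} (hj : 1 ≤ j) (he : 2 * d - 1 ≤ 2 * e)
    (A : Finset K) (hA₁ : ∀ a ∈ A, σ a = a ∧ Valued.v a = 1)
    (hA₂ : ∀ u : K, σ u = u → Valued.v u = 1 → ∃ a ∈ A, Valued.v (u - a) ≤ Valued.v ϖ ^ (2 * e))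
    (hA₃ : ∀ a ∈ A, ∀ a' ∈ A, Valued.v (a - a') ≤ Valued.v ϖ ^ (2 * e) → a = a') :
    ∑ u ∈ A, ∑ u' ∈ A, normSign σ u' * normSign σ (C₀ * u' + C₁ * (ϖ * σ ϖ) ^ j * u) = (A.card : ℤ) * ∑ a ∈ A, normSign σ (C₀ + C₁ * (ϖ * σ ϖ) ^ j * a) := by
  classical
  rw [Finset.sum_comm]
  have hin : ∀ u' ∈ A, ∑ u ∈ A, normSign σ u' * normSign σ (C₀ * u' + C₁ * (ϖ * σ ϖ) ^ j * u) = ∑ a ∈ A, normSign σ (C₀ + C₁ * (ϖ * σ ϖ) ^ j * a) := by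
    intro u' hu'
    have hsq : normSign σ u' * normSign σ u' = 1 := by
      unfold normSign; split_ifs <;> norm_num
    rw [← Finset.mul_sum, sum_normSign_linear_eq hD hσC₀ hC₀ hσC₁ hC₁ hj he A hA₁ hA₂ hA₃ hu', ← mul_assoc, hsq, one_mul]
  rw [Finset.sum_congr rfl hin, Finset.sum_const, nsmul_eq_mul]

/-- **THE TWISTED SINGLE SUM VANISHES**: `Σ_{a ∈ A} ω(a)·ω(C₀ + C₁ϖ_F^j a) = 0` (`|2| < 1`, `2d − 1 ≤ 2e`, `j ≥ 1`): with the toolkit's non-norm `c ∈ U_F(2d−2)` the map `a ↦ rep(c·a)`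
permutes `A`, flips `ω(a)` (★ `normSign_mul_eq_neg_of_not_norm`) and does NOT move `ω(C₀ + C₁ϖ_F^j a)` (the value shifts by `C₁ϖ_F^j a(c−1)`, of valuation `≤ |ϖ|^{2j+2d−2} ≤ |ϖ|^{2d−1}`).
[cite: Serre1979, Ch. V §3 Cor. 3; Ch. XV §2 Cor. 2] -/
theorem sum_normSign_mul_affine_eq_zero [CompleteSpace K] [Finite 𝓀[K]] (hD : IsRamifiedQuadraticDatum σ ϖ d t) (h2v : Valued.v (2 : K) < 1)
    {C₀ C₁ : K} (hσC₀ : σ C₀ = C₀) (hC₀ : Valued.v C₀ = 1) (hσC₁ : σ C₁ = C₁) (hC₁ : Valued.v C₁ ≤ 1) {j e : ℕ} (hj : 1 ≤ j) (he : 2 * d - 1 ≤ 2 * e)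
    (A : Finset K) (hA₁ : ∀ a ∈ A, σ a = a ∧ Valued.v a = 1)
    (hA₂ : ∀ u : K, σ u = u → Valued.v u = 1 → ∃ a ∈ A, Valued.v (u - a) ≤ Valued.v ϖ ^ (2 * e))
    (hA₃ : ∀ a ∈ A, ∀ a' ∈ A, Valued.v (a - a') ≤ Valued.v ϖ ^ (2 * e) → a = a') :
    ∑ a ∈ A, normSign σ a * normSign σ (C₀ + C₁ * (ϖ * σ ϖ) ^ j * a) = 0 := by
  classical
  obtain ⟨hσ, hvσ, hϖ, -, -, hd1, -⟩ := id hD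
  have hϖ1 : Valued.v ϖ ≤ 1 := by rw [hϖ, ← exp_zero]; exact exp_le_exp.2 (by norm_num)
  have hπ : σ (ϖ * σ ϖ) = ϖ * σ ϖ := by rw [map_mul, hσ, mul_comm]
  have hfx : ∀ y : K, σ y = y → σ (C₀ + C₁ * (ϖ * σ ϖ) ^ j * y) = C₀ + C₁ * (ϖ * σ ϖ) ^ j * y := fun y hy => by
    rw [map_add, hσC₀, map_mul, map_mul, hσC₁, map_pow, hπ, hy]
  obtain ⟨c, hσc, hc1, hcU, hcn⟩ := exists_fixed_unit_not_norm_v_sub_one_le hD h2v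
  have hcU' : Valued.v (c - 1) ≤ Valued.v ϖ ^ (2 * (d - 1)) := by
    rw [hϖ, ← exp_nsmul, nsmul_eq_mul, mul_neg, mul_one]; exact_mod_cast hcU
  have hsmall : Valued.v ϖ ^ (2 * e) < 1 := by
    rw [hϖ, ← exp_nsmul, nsmul_eq_mul, mul_neg, mul_one, ← exp_zero]; exact exp_lt_exp.2 (by omega)
  -- the involution `a ↦ rep(c·a)`
  have hca : ∀ a ∈ A, σ (c * a) = c * a ∧ Valued.v (c * a) = 1 := fun a ha => by
    obtain ⟨hσa, ha1⟩ := hA₁ a ha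
    exact ⟨by rw [map_mul, hσc, hσa], by rw [map_mul, hc1, ha1, one_mul]⟩
  have hrep : ∀ a ∈ A, ∃ a' ∈ A, Valued.v (c * a - a') ≤ Valued.v ϖ ^ (2 * e) := fun a ha => hA₂ _ (hca a ha).1 (hca a ha).2
  choose! Φ hΦA hΦ using hrep
  -- termwise flip
  have hflip : ∀ a ∈ A, normSign σ (Φ a) * normSign σ (C₀ + C₁ * (ϖ * σ ϖ) ^ j * Φ a) = -(normSign σ a * normSign σ (C₀ + C₁ * (ϖ * σ ϖ) ^ j * a)) := by
    intro a ha
    obtain ⟨hσa, ha1⟩ := hA₁ a ha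
    have ha0 : a ≠ 0 := fun h => by rw [h, map_zero] at ha1; exact zero_ne_one ha1
    -- `ω(Φ a) = ω(c a) = −ω(a)`
    have h1 : normSign σ (Φ a) = -normSign σ a := by
      rw [normSign_eq_of_near hD (hca a ha).1 (hA₁ _ (hΦA a ha)).1 (hca a ha).2 he (hΦ a ha), normSign_mul_eq_neg_of_not_norm hD hσc hcn hσa ha0]
    -- `ω(C₀ + C₁ϖ_F^j Φ a) = ω(C₀ + C₁ϖ_F^j c a) = ω(C₀ + C₁ϖ_F^j a)`
    have h2 : normSign σ (C₀ + C₁ * (ϖ * σ ϖ) ^ j * Φ a) = normSign σ (C₀ + C₁ * (ϖ * σ ϖ) ^ j * a) := by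
      rw [normSign_affine_eq_of_near hD hσC₀ hC₀ hσC₁ hC₁ (hca a ha).1 (hca a ha).2.le (hA₁ _ (hΦA a ha)).1 hj he (hΦ a ha)]
      refine normSign_eq_of_near hD (hfx a hσa) (hfx (c * a) (hca a ha).1) (v_affine_eq_one hD hC₀ hC₁ ha1.le hj) le_rfl ?_
      rw [show C₀ + C₁ * (ϖ * σ ϖ) ^ j * a - (C₀ + C₁ * (ϖ * σ ϖ) ^ j * (c * a)) = -(C₁ * (ϖ * σ ϖ) ^ j * a * (c - 1)) by ring, Valuation.map_neg,
        map_mul, map_mul, map_mul, ha1, mul_one]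
      calc Valued.v C₁ * Valued.v ((ϖ * σ ϖ) ^ j) * Valued.v (c - 1) ≤ 1 * Valued.v ϖ ^ 2 * Valued.v ϖ ^ (2 * (d - 1)) := by
            refine mul_le_mul' (mul_le_mul' hC₁ ?_) hcU'
            rw [map_pow, map_mul, hvσ, ← sq, ← pow_mul]
            exact pow_le_pow_right_of_le_one' hϖ1 (by omega)
        _ = Valued.v ϖ ^ (2 * d) := by rw [one_mul, ← pow_add]; congr 1; omega
        _ ≤ Valued.v ϖ ^ (2 * d - 1) := pow_le_pow_right_of_le_one' hϖ1 (by omega)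
    rw [h1, h2]; ring
  -- `Φ` is a bijection of `A`
  have hinj : ∀ a₁ ∈ A, ∀ a₂ ∈ A, Φ a₁ = Φ a₂ → a₁ = a₂ := by
    intro a₁ ha₁ a₂ ha₂ heq
    refine hA₃ a₁ ha₁ a₂ ha₂ ?_
    have h1 : Valued.v (c * a₁ - c * a₂) ≤ Valued.v ϖ ^ (2 * e) := by
      rw [show c * a₁ - c * a₂ = (c * a₁ - Φ a₁) - (c * a₂ - Φ a₂) by rw [heq]; ring]
      exact (Valuation.map_sub _ _ _).trans (max_le (hΦ a₁ ha₁) (hΦ a₂ ha₂))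
    rwa [← mul_sub, map_mul, hc1, one_mul] at h1
  have hsum : ∑ a ∈ A, normSign σ (Φ a) * normSign σ (C₀ + C₁ * (ϖ * σ ϖ) ^ j * Φ a) = ∑ a ∈ A, normSign σ a * normSign σ (C₀ + C₁ * (ϖ * σ ϖ) ^ j * a) :=
    Finset.sum_bij (fun a _ => Φ a) (fun a ha => hΦA a ha) (fun a₁ ha₁ a₂ ha₂ h => hinj a₁ ha₁ a₂ ha₂ h)
      (fun a' ha' => by
        have himg : A.image Φ = A := Finset.eq_of_subset_of_card_le (Finset.image_subset_iff.2 fun a ha => hΦA a ha)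
          (by rw [Finset.card_image_of_injOn (fun a₁ ha₁ a₂ ha₂ h => hinj a₁ ha₁ a₂ ha₂ h)])
        have h' : a' ∈ A.image Φ := by rw [himg]; exact ha'
        obtain ⟨a, ha, haa'⟩ := Finset.mem_image.1 h'
        exact ⟨a, ha, haa'⟩)
      (fun _ _ => rfl)
  have hneg : ∑ a ∈ A, normSign σ (Φ a) * normSign σ (C₀ + C₁ * (ϖ * σ ϖ) ^ j * Φ a) = -∑ a ∈ A, normSign σ a * normSign σ (C₀ + C₁ * (ϖ * σ ϖ) ^ j * a) := by
    rw [← Finset.sum_neg_distrib]; exact Finset.sum_congr rfl hflip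
  have h2 : (2 : ℤ) * ∑ a ∈ A, normSign σ a * normSign σ (C₀ + C₁ * (ϖ * σ ϖ) ^ j * a) = 0 := by linarith
  simpa using h2

/-- **(ii) THE `ω(u)`-WEIGHTED DOUBLE SUM VANISHES**: `Σ_{u ∈ A} Σ_{u′ ∈ A} ω(u)·ω(C₀u′ + C₁ϖ_F^j u) = 0` (`|2| < 1`, `2d − 1 ≤ 2e`, `j ≥ 1`): at fixed `u′`, `ω(u) = ω(u′)·ω(u∕u′)`
(class function) so the inner sum is `ω(u′)²·Σ_a ω(a)ω(C₀ + C₁ϖ_F^j a) = 0` by the twisted single sum. [cite: Serre1979, Ch. V §3 Cor. 3; Ch. XV §2] -/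
theorem sum_sum_normSign_fst_mul_linear_eq_zero [CompleteSpace K] [Finite 𝓀[K]] (hD : IsRamifiedQuadraticDatum σ ϖ d t) (h2v : Valued.v (2 : K) < 1)
    {C₀ C₁ : K} (hσC₀ : σ C₀ = C₀) (hC₀ : Valued.v C₀ = 1) (hσC₁ : σ C₁ = C₁) (hC₁ : Valued.v C₁ ≤ 1) {j e : ℕ} (hj : 1 ≤ j) (he : 2 * d - 1 ≤ 2 * e)
    (A : Finset K) (hA₁ : ∀ a ∈ A, σ a = a ∧ Valued.v a = 1)
    (hA₂ : ∀ u : K, σ u = u → Valued.v u = 1 → ∃ a ∈ A, Valued.v (u - a) ≤ Valued.v ϖ ^ (2 * e))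
    (hA₃ : ∀ a ∈ A, ∀ a' ∈ A, Valued.v (a - a') ≤ Valued.v ϖ ^ (2 * e) → a = a') :
    ∑ u ∈ A, ∑ u' ∈ A, normSign σ u * normSign σ (C₀ * u' + C₁ * (ϖ * σ ϖ) ^ j * u) = 0 := by
  classical
  obtain ⟨hσ, hvσ, hϖ, -, -, hd1, -⟩ := id hD
  rw [Finset.sum_comm]
  refine Finset.sum_eq_zero fun u' hu' => ?_
  obtain ⟨hσu', hu'1⟩ := hA₁ u' hu'
  have hu'0 : u' ≠ 0 := fun h => by rw [h, map_zero] at hu'1; exact zero_ne_one hu'1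
  have hq : ∀ u ∈ A, σ (u / u') = u / u' ∧ Valued.v (u / u') = 1 := fun u hu => by
    obtain ⟨hσu, hu1⟩ := hA₁ u hu
    exact ⟨by rw [map_div₀, hσu, hσu'], by rw [map_div₀, hu1, hu'1, div_one]⟩
  have hrep : ∀ u ∈ A, ∃ a ∈ A, Valued.v (u / u' - a) ≤ Valued.v ϖ ^ (2 * e) := fun u hu => hA₂ _ (hq u hu).1 (hq u hu).2
  choose! Φ hΦA hΦ using hrep
  -- termwise: `ω(u)·ω(C₀u′ + C₁ϖ_F^j u) = ω(Φ u)·ω(C₀ + C₁ϖ_F^j Φ u)` (`ω(u′)² = 1`)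
  have hterm : ∀ u ∈ A, normSign σ u * normSign σ (C₀ * u' + C₁ * (ϖ * σ ϖ) ^ j * u) =
      normSign σ (Φ u) * normSign σ (C₀ + C₁ * (ϖ * σ ϖ) ^ j * Φ u) := by
    intro u hu
    obtain ⟨hσu, hu1⟩ := hA₁ u hu
    have hu0 : u ≠ 0 := fun h => by rw [h, map_zero] at hu1; exact zero_ne_one hu1
    have hv1 := v_affine_eq_one hD hC₀ hC₁ (hq u hu).2.le hj
    have hωu : normSign σ u = normSign σ u' * normSign σ (Φ u) := by
      rw [normSign_eq_of_near hD (hq u hu).1 (hA₁ _ (hΦA u hu)).1 (hq u hu).2 he (hΦ u hu), ← normSign_mul_of_fixed hD hσu' (hq u hu).1 hu'0 (div_ne_zero hu0 hu'0),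
        mul_div_cancel₀ _ hu'0]
    rw [hωu, normSign_linear_eq_mul hD hσC₀ hσC₁ hσu hσu' hu'0 j (fun h => by rw [h, map_zero] at hv1; exact zero_ne_one hv1),
      ← normSign_affine_eq_of_near hD hσC₀ hC₀ hσC₁ hC₁ (hq u hu).1 (hq u hu).2.le (hA₁ _ (hΦA u hu)).1 hj he (hΦ u hu)]
    have hsq : normSign σ u' * normSign σ u' = 1 := by
      unfold normSign; split_ifs <;> norm_num
    calc normSign σ u' * normSign σ (Φ u) * (normSign σ u' * normSign σ (C₀ + C₁ * (ϖ * σ ϖ) ^ j * Φ u))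
        = (normSign σ u' * normSign σ u') * (normSign σ (Φ u) * normSign σ (C₀ + C₁ * (ϖ * σ ϖ) ^ j * Φ u)) := by ring
      _ = _ := by rw [hsq, one_mul]
  rw [Finset.sum_congr rfl hterm]
  -- re-index by the bijection `Φ` and apply the twisted single sum
  have hinj : ∀ u₁ ∈ A, ∀ u₂ ∈ A, Φ u₁ = Φ u₂ → u₁ = u₂ := by
    intro u₁ hu₁ u₂ hu₂ heq
    refine hA₃ u₁ hu₁ u₂ hu₂ ?_
    have h1 : Valued.v (u₁ / u' - u₂ / u') ≤ Valued.v ϖ ^ (2 * e) := by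
      rw [show u₁ / u' - u₂ / u' = (u₁ / u' - Φ u₁) - (u₂ / u' - Φ u₂) by rw [heq]; ring]
      exact (Valuation.map_sub _ _ _).trans (max_le (hΦ u₁ hu₁) (hΦ u₂ hu₂))
    rwa [← sub_div, map_div₀, hu'1, div_one] at h1
  rw [Finset.sum_bij (s := A) (t := A) (g := fun a => normSign σ a * normSign σ (C₀ + C₁ * (ϖ * σ ϖ) ^ j * a)) (fun u _ => Φ u) (fun u hu => hΦA u hu)
    (fun u₁ hu₁ u₂ hu₂ h => hinj u₁ hu₁ u₂ hu₂ h)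
    (fun a ha => by
      have himg : A.image Φ = A := Finset.eq_of_subset_of_card_le (Finset.image_subset_iff.2 fun u hu => hΦA u hu)
        (by rw [Finset.card_image_of_injOn (fun u₁ hu₁ u₂ hu₂ h => hinj u₁ hu₁ u₂ hu₂ h)])
      have ha' : a ∈ A.image Φ := by rw [himg]; exact ha
      obtain ⟨u, hu, hua⟩ := Finset.mem_image.1 ha'
      exact ⟨u, hu, hua⟩)
    (fun _ _ => rfl)]
  exact sum_normSign_mul_affine_eq_zero hD h2v hσC₀ hC₀ hσC₁ hC₁ hj he A hA₁ hA₂ hA₃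

end Summit.HodgeConjecture.HodgeConjecture.Cruxes.H413.F0P3cDyRamBinaryLinearFormDoubleSums

end
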